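import Summits.BirchSwinnertonDyer.BirchSwinnertonDyer.Theorems.ManinLocalTwoThreeManinPrimeToAdditiveFiveLeKatoReduction
import Summits.BirchSwinnertonDyer.BirchSwinnertonDyer.Theorems.ManinLocalTwoThreeManinPrimeToAdditiveFiveLeReducibleResidueOfFacts
import HarnessLib

/-!
# Route `ManinLocalTwoThree`, residual crux C5 `ManinPrimeToAdditiveFiveLe`
# (stmt-BirchSwinnertonDyer-22969), line `upper_anchor`: THE LINE'S LEDGER IN ONE THEOREM —
# **C5 BY NAME ⟸ five PRINTED facts + three OPEN cores** (conditional; C5 is NOT proved)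

Glue of the two landed reductions of the line:
* the lead's KATO REDUCTION `maninLocalTwoThree_maninPrimeToAdditiveFiveLe_of_kato_of_cores`
  (p608285, seat bsd-line-ml23-c5-p1): C5 ⟸ F′ ∧ F″ ∧ core(KP) ∧ (RED) — where (RED) is VERBATIM the
  registered stub `stub_reducibleTwistMinimal` (the `W[p]`-reducible residue);
* the width seat's `reducibleTwistMinimal_of_edixhoven_cns_of_cores` (p608852, seat
  bsd-line-ml23-c5-p1-w2): (RED) ⟸ Edixhoven 1991 Thm. 3 (both cite-only halves) ∧ ČNS Thm. 1.2 ∧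
  RED(57) ∧ RED(11).

So `maninPrimeToAdditiveFiveLe_of_print_of_cores`: crux C5
`Summit.BirchSwinnertonDyer.BirchSwinnertonDyer.Theses.ManinLocalTwoThree.ManinPrimeToAdditiveFiveLe`
FOLLOWS from
* five PRINTED, statement-only Literature facts, none a hypothesis of C5:
  F′ `kato_neron_isIntegral_twistedSymbolSum_of_additive` (Kato 2004 (8.1.3)/Thm. 9.7 + Kim–Nakamura
  2020, additive `p > 7`), F″ `kato_neron_isIntegral_twistedSymbolSum_of_additive_five_le` (the same
  at `p ≥ 5` off the Kosters–Pannekoek exception), Edixhoven 1991 Thm. 3 in its two halves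
  `edixhoven_not_dvd_maninConstant_of_kodairaSymbol_ne` / `…_of_not_potentiallyGoodOrdinary`, and
  Česnavičius–Neururer–Saha 2024 Thm. 1.2 `cesnaviciusNeururerSaha_padicVal_maninConstant_le_modularDegree`;
* three OPEN cores, each on globally twist-minimal classes with conductor-level lattice-optimal data
  and `p² ∣ N`: core(KP) — `p ∈ {5,7}`, `E[p]` irreducible, a `ℚ_p`-point of order `p` (crux KP57,
  stmt-BirchSwinnertonDyer-23810, territory); RED(57) — `p ∈ {5,7}`, `E[p]` reducible; RED(11) —
  `p > 7`, `E[p]` reducible, Kodaira II/III/IV (`ord_p Δ_min ≤ 4`), potentially good ordinary in the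
  (G)-shape, `p ∣ deg φ` (met in Cremona's range by the `X₀(13)` family R₁₃, lead's evidence #6).

HONEST STATUS: conditional-result (`--supports … --as helper`); closes nothing; records by name that,
granted print as transcribed in the tree, the open content of Manin's `p ∤ c` at additive `p ≥ 5`
is core(KP) ∪ RED(57) ∪ RED(11). Nothing here proves BSD, Manin's conjecture or C5.
Seat bsd-line-ml23-c5-p1-w2 (width prover), allocation δ′ (HOME INBOX 2026-08-28T06:2xZ).

References: [Kato2004Asterisque] (8.1.3), Thm. 9.7; [KimNakamura2020] Cor. 2.4; [KostersPannekoek2017]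
Thm. 1; [EdixhovenManin1991] Thm. 3; [CesnaviciusNeururerSaha2023] Thm. 1.2; [AgasheRibetStein2006] §2.
-/

set_option autoImplicit false
-- the Theorems namespace of this sub repeats the summit name by design (D-0017 nested layout)
set_option linter.dupNamespace false

noncomputable section

open scoped Classical NumberField

namespace Summit.BirchSwinnertonDyer.BirchSwinnertonDyer.Theorems

open WeierstrassCurve IsDedekindDomain NumberField
  Literature.NumberTheory.EllipticCurves Literature.NumberTheory.EllipticCurves.ModularForms
  Literature.NumberTheory.EllipticCurves.Rank1Residual
  Summit.BirchSwinnertonDyer.Rank1Residual.ManinAdditive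

/-- **C5 `ManinPrimeToAdditiveFiveLe` BY NAME ⟸ five printed facts + three open cores** (the line
`upper_anchor`'s ledger; conditional-result, C5 is NOT proved): Kato F′ (`hK`), Kato F″ (`hK57`),
Edixhoven Thm. 3 Kodaira half (`hEdK`) and ordinarity half (`hEdG`), ČNS Thm. 1.2 (`hCNS`); cores
core(KP) (`hKP`), RED(57) (`h57`), RED(11) (`h11`). Proof: the lead's Kato reduction fed with the
width seat's reduction of the reducible residue. [cite: Kato2004Asterisque, (8.1.3) (p. 180), Thm. 9.7 (p. 189)]
[cite: EdixhovenManin1991, Thm. 3] [cite: CesnaviciusNeururerSaha2023, Thm. 1.2] -/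
theorem maninPrimeToAdditiveFiveLe_of_print_of_cores
    (hK : kato_neron_isIntegral_twistedSymbolSum_of_additive)
    (hK57 : kato_neron_isIntegral_twistedSymbolSum_of_additive_five_le)
    (hEdK : edixhoven_not_dvd_maninConstant_of_kodairaSymbol_ne)
    (hEdG : edixhoven_not_dvd_maninConstant_of_not_potentiallyGoodOrdinary)
    (hCNS : cesnaviciusNeururerSaha_padicVal_maninConstant_le_modularDegree)
    (hKP : ∀ (W : WeierstrassCurve ℚ) [W.IsElliptic] [W.IsGloballyMinimal]
      [NeZero (W.conductorNorm ℤ)] (D : ModularParametrizationData W (W.conductorNorm ℤ)),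
      IsLatticeOptimal D → ∀ (p : ℕ) [Fact p.Prime], (p = 5 ∨ p = 7) → p ^ 2 ∣ W.conductorNorm ℤ →
      ¬ (∃ (W' : WeierstrassCurve ℚ) (q : ℕ), W'.IsElliptic ∧ W'.IsGloballyMinimal ∧
          q.Prime ∧ q ≠ 2 ∧ q ^ 2 ∣ W.conductorNorm ℤ ∧
          IsIsogenous W (W'.quadraticTwist (((-1 : ℤ) ^ (q / 2) * q : ℤ) : ℚ)) ∧
          ¬ q ^ 2 ∣ W'.conductorNorm ℤ) →
      ¬ (∃ (W' : WeierstrassCurve ℚ) (d : ℤ), W'.IsElliptic ∧ W'.IsGloballyMinimal ∧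
          (d = -1 ∨ d = 2 ∨ d = -2) ∧ 2 ^ 2 ∣ W.conductorNorm ℤ ∧
          IsIsogenous W (W'.quadraticTwist (d : ℚ)) ∧ ¬ 2 ^ 2 ∣ W'.conductorNorm ℤ) →
      W.HasIrreducibleModPGaloisRep p →
      (∃ P : (W.baseChange ℚ_[p]).toAffine.Point, p • P = 0 ∧ P ≠ 0) →
      ¬ (p : ℤ) ∣ D.maninConstant)
    (h57 : mazur_not_dvd_maninConstant_of_odd → abbesUllmo_not_dvd_maninConstant_of_not_dvd_level →
      cesnavicius_not_two_dvd_maninConstant_of_two_dvd_level → exists_isNewformOf →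
      ∀ (W : WeierstrassCurve ℚ) [W.IsElliptic] [W.IsGloballyMinimal] [NeZero (W.conductorNorm ℤ)]
        (D : ModularParametrizationData W (W.conductorNorm ℤ)),
        IsLatticeOptimal D → ∀ p : ℕ, p.Prime → (p = 5 ∨ p = 7) → p ^ 2 ∣ W.conductorNorm ℤ →
        ¬ (∃ (W' : WeierstrassCurve ℚ) (q : ℕ), W'.IsElliptic ∧ W'.IsGloballyMinimal ∧ q.Prime ∧
            q ≠ 2 ∧ q ^ 2 ∣ W.conductorNorm ℤ ∧
            IsIsogenous W (W'.quadraticTwist (((-1 : ℤ) ^ (q / 2) * q : ℤ) : ℚ)) ∧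
            ¬ q ^ 2 ∣ W'.conductorNorm ℤ) →
        ¬ (∃ (W' : WeierstrassCurve ℚ) (d : ℤ), W'.IsElliptic ∧ W'.IsGloballyMinimal ∧
            (d = -1 ∨ d = 2 ∨ d = -2) ∧ 2 ^ 2 ∣ W.conductorNorm ℤ ∧
            IsIsogenous W (W'.quadraticTwist (d : ℚ)) ∧ ¬ 2 ^ 2 ∣ W'.conductorNorm ℤ) →
        ¬ W.HasIrreducibleModPGaloisRep p →
        ¬ (p : ℤ) ∣ D.maninConstant)
    (h11 : mazur_not_dvd_maninConstant_of_odd → abbesUllmo_not_dvd_maninConstant_of_not_dvd_level →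
      cesnavicius_not_two_dvd_maninConstant_of_two_dvd_level → exists_isNewformOf →
      ∀ (W : WeierstrassCurve ℚ) [W.IsElliptic] [W.IsGloballyMinimal] [NeZero (W.conductorNorm ℤ)]
        (D : ModularParametrizationData W (W.conductorNorm ℤ)),
        IsLatticeOptimal D → ∀ p : ℕ, p.Prime → 7 < p → p ^ 2 ∣ W.conductorNorm ℤ →
        ¬ (∃ (W' : WeierstrassCurve ℚ) (q : ℕ), W'.IsElliptic ∧ W'.IsGloballyMinimal ∧ q.Prime ∧
            q ≠ 2 ∧ q ^ 2 ∣ W.conductorNorm ℤ ∧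
            IsIsogenous W (W'.quadraticTwist (((-1 : ℤ) ^ (q / 2) * q : ℤ) : ℚ)) ∧
            ¬ q ^ 2 ∣ W'.conductorNorm ℤ) →
        ¬ (∃ (W' : WeierstrassCurve ℚ) (d : ℤ), W'.IsElliptic ∧ W'.IsGloballyMinimal ∧
            (d = -1 ∨ d = 2 ∨ d = -2) ∧ 2 ^ 2 ∣ W.conductorNorm ℤ ∧
            IsIsogenous W (W'.quadraticTwist (d : ℚ)) ∧ ¬ 2 ^ 2 ∣ W'.conductorNorm ℤ) →
        ¬ W.HasIrreducibleModPGaloisRep p →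
        padicValInt p W.minimalDiscriminantInt ≤ 4 →
        (∃ (L : Type) (_ : Field L) (_ : NumberField L) (_ : IsCyclotomicExtension {p} ℚ L)
            (F : IntermediateField ℚ L),
            ∀ w : HeightOneSpectrum (𝓞 F), (p : 𝓞 F) ∈ w.asIdeal →
              (W.baseChange F).HasGoodReductionAt w ∧ (W.baseChange F).HasUnitRootAt w) →
        p ∣ D.modularDegree →
        ¬ (p : ℤ) ∣ D.maninConstant) :
    Summit.BirchSwinnertonDyer.BirchSwinnertonDyer.Theses.ManinLocalTwoThree.ManinPrimeToAdditiveFiveLe :=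
  maninLocalTwoThree_maninPrimeToAdditiveFiveLe_of_kato_of_cores hK hK57 hKP
    (reducibleTwistMinimal_of_edixhoven_cns_of_cores hEdK hEdG hCNS h57 h11)

end Summit.BirchSwinnertonDyer.BirchSwinnertonDyer.Theorems

end
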